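import Summits.NavierStokesRegularity.NavierStokesRegularity.Theorems.EulerZoomLiouvillePowerGaugeEulerLiouvilleSelfSimilarEnergyEquality
import Summits.NavierStokesRegularity.NavierStokesRegularity.Theorems.EulerZoomLiouvillePowerGaugeEulerLiouvilleSelfSimilarDeflation
import HarnessLib

/-!
# No finite-energy exactly self-similar member in the energy-deflation range `0 < ρ < 1/2`
# (crux `EulerZoomLiouville.PowerGaugeEulerLiouville` = stmt-NavierStokesRegularity-19832, line `birth`, rung C1)

Route `EulerZoomLiouville` (NavierStokesRegularity).  MEMBER-LEVEL stratum of the open stub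
(`stub_energeticPast`, exactly self-similar sub-family = rung C1): the crux's hypotheses VERBATIM (suitable weak
ancient Euler pair on the slab, weak gradient, the three power gauges with `0 < ρ < 1/2`) + exact
self-similarity with a profile of FINITE ENERGY and integrable Bernoulli flux (`V ∈ L² ∩ L³(ℝ³)`,
`P ∈ L^{3/2}(ℝ³)`) ⇒ `u = 0` a.e. on the slab (`selfSimilar_ae_eq_zero_of_finiteEnergy_profile`).  Composition of
`selfSimilar_profile_local_energy_equality` (the profile local energy EQUALITY of class members — it uses the
Euler momentum identity) with the energy-deflation Liouville `ProfileEnergy.profile_ae_eq_zero_of_energyEquality`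
(`γ = 1/(2+ρ) > 2/5`) and the lineage's `selfSimilar_ae_eq_zero_of_profile`.  In this range the total energy
`(−t)^{5γ−2}‖V‖₂²` of such a member DEFLATES to `0` at the blow-up time, which the one-sided local energy
inequality allows and the energy EQUALITY forbids.  Honest scope: the natural in-window candidates have
infinite energy; this removes the finite-energy `L³` ones.  WHAT THIS IS NOT: not NS regularity, not the crux;
`--supports` stmt-19832. [folklore; cf. ChaeShvydkoy2013 §1]
-/

noncomputable section

set_option linter.dupNamespace false

open MeasureTheory Set Filter Topology Metric Function TopologicalSpace
open scoped ENNReal NNReal RealInnerProductSpace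

namespace Summit.NavierStokesRegularity.NavierStokesRegularity.Theorems.PowerGaugeEulerLiouville

open Literature.Analysis Literature.Analysis.FunctionSpaces Literature.Analysis.FluidPDE

/-- **No finite-energy exactly self-similar member for `0 < ρ < 1/2`.**  Crux hypotheses verbatim + exact
self-similarity (`γ = 1/(2+ρ)`) with `V ∈ L² ∩ L³(ℝ³)`, `P ∈ L^{3/2}(ℝ³)` ⇒ `u = 0` a.e. on the slab.
[folklore; cf. ChaeShvydkoy2013 §1] -/
theorem selfSimilar_ae_eq_zero_of_finiteEnergy_profile {ρ : ℝ} (hρ : 0 < ρ) (hρ2 : ρ < 1 / 2)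
    {u : ℝ → EuclideanSpace ℝ (Fin 3) → EuclideanSpace ℝ (Fin 3)} {p : ℝ → EuclideanSpace ℝ (Fin 3) → ℝ}
    {H : ℝ → EuclideanSpace ℝ (Fin 3) → EuclideanSpace ℝ (Fin 3) →L[ℝ] EuclideanSpace ℝ (Fin 3)} {c : ℝ≥0}
    (hsw : IsSuitableWeakSolutionOn (slab (EuclideanSpace ℝ (Fin 3)) (Iio 0) isOpen_Iio) 0 0 u p)
    (hH : HasWeakSpatialGradientOn (slab (EuclideanSpace ℝ (Fin 3)) (Iio 0) isOpen_Iio) u H)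
    (hgauge : ∀ a : ℝ, 0 < a →
      ENNReal.ofReal (a ^ (2 * ρ)) * cknA a (0 : ℝ × EuclideanSpace ℝ (Fin 3)) u +
          ENNReal.ofReal (a ^ ρ) * cknE a (0 : ℝ × EuclideanSpace ℝ (Fin 3)) H +
        ENNReal.ofReal (a ^ (2 * ρ)) * cknD a (0 : ℝ × EuclideanSpace ℝ (Fin 3)) p ≤ (c : ℝ≥0∞))
    {V : EuclideanSpace ℝ (Fin 3) → EuclideanSpace ℝ (Fin 3)} {P : EuclideanSpace ℝ (Fin 3) → ℝ}
    (hu : ∀ τ : ℝ, τ < 0 → u τ = selfSimilarCollapse (1 / (2 + ρ)) 0 V τ)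
    (hp : ∀ τ : ℝ, τ < 0 → p τ = selfSimilarCollapsePressure (1 / (2 + ρ)) 0 P τ)
    (hV2 : MemLp V 2 volume) (hV3 : MemLp V 3 volume) (hP32 : MemLp P (3 / 2 : ℝ≥0∞) volume) :
    uncurry u =ᵐ[volume.restrict (Iio (0 : ℝ) ×ˢ (univ : Set (EuclideanSpace ℝ (Fin 3))))] 0 := by
  have hγ : (1 : ℝ) / (2 + ρ) ≠ 2 / 5 := by
    have h2ρ : 0 < 2 + ρ := by linarith
    rw [ne_eq, div_eq_div_iff h2ρ.ne' (by norm_num)]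
    intro h; linarith
  have hEE := fun (σ : EuclideanSpace ℝ (Fin 3) → ℝ)
      (hσ : IsTestFunctionOn (⊤ : Opens (EuclideanSpace ℝ (Fin 3))) σ) =>
    selfSimilar_profile_local_energy_equality hρ (by linarith) hsw hH hgauge hu hp hσ
  have hV0 : V =ᵐ[volume] 0 := ProfileEnergy.profile_ae_eq_zero_of_energyEquality hγ hEE hV2 hV3 hP32
  have hum : AEStronglyMeasurable (uncurry u)
      (volume.restrict (Iio (0 : ℝ) ×ˢ (univ : Set (EuclideanSpace ℝ (Fin 3))))) := by
    have := hH.locallyIntegrableOn.aestronglyMeasurable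
    simpa [slab] using this
  exact selfSimilar_ae_eq_zero_of_profile hum hu hV0

end Summit.NavierStokesRegularity.NavierStokesRegularity.Theorems.PowerGaugeEulerLiouville
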